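import Summits.BirchSwinnertonDyer.Rank1Residual.GaloisImage.PrimeChoiceLocal
import Summits.BirchSwinnertonDyer.Rank1Residual.X11b.MaxUnramifiedRestriction
import Literature.NumberTheory.GaloisCohomology.FiniteSingularComparison
import HarnessLib

/-!
# From the cocycle form of THEOREM C to the finite–singular relation `loc^s_𝔮 = φ^{fs}_𝔮 ∘ loc_𝔮`
# of a Kolyvagin datum with the canonical comparison maps — the local–global glue
# (cell `b2b-bsdres`, n1011 p11 GEN 9; row T-DER, file C5a; consumer: `fs_rel` of Kato's classes)

HONEST FRAMING (cell `b2b-bsdres`, run/shared/lean/b2b/bsd-rank1-residual/, verbatim in every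
file): the goal of the cell is to DELETE the COMBINATION-SHAPED residual classes of the
Birch–Swinnerton-Dyer formula for ALL analytic-rank `≤ 1` elliptic curves over `ℚ` — "full BSD
formula for every rank `≤ 1` curve in class `C`" assembled STRICTLY from published theorems — so
that the rank-`≤ 1` remainder becomes exactly the CONSTRUCTION-SHAPED classes, which are TYPED
(missing-input `Prop`s), NOT attempted. This is not "finishing BSD". Team n1011: research route on
the CONSTRUCTION-SHAPED class X4 / §I N11 (route-1 PORT, (P-DER)); TOOL theorem of Galois
cohomology over a number field; no definition, no named fact, no `sorry`.

## What

`K` a number field, `ρ : Γ_K → Aut(M)` a discrete module free of finite rank over `ℤ/N`,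
`D : KolyvaginDatum ρ` whose comparison maps ARE the canonical ones in Kim's generator-fixed
convention `η` (`D.HasCanonicalComparison N η`, tree `FiniteSingularComparison.lean`), `𝔮 ∈ 𝒫`,
`𝔓₀ = adicCompletionPrime K 𝔮` the prime of `\bar ℤ_K` of the fixed embedding `K̄ → \bar K_𝔮`
(`I_{𝔓₀} = res I_{K_𝔮}`, `Frob_{𝔓₀} ↔ Frob_{K_𝔮}`: tree `DecompositionGroupOfCompletion`).
For GLOBAL continuous cocycles `Φ, Φ_r : Γ_K → M` with
* `ρ` unramified at `𝔓₀` (`hI`) and `Φ_r(I_{𝔓₀}) = 0` (`hΦr`) — so `loc_𝔮 [Φ_r]` is unramified;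
* the COCYCLE FORM of the finite–singular relation at `𝔓₀` (`hΦ`, = THEOREM C of row T-DER /
  E4b `Derivative.Rat.apply_eq_aeval_apply_of_mem_inertia_of_eulerSystem` for Kato-type classes):
  `Φ(τ) = Q(φ⁻¹)·Φ_r(φ)` (`ρ.comparisonOp N φ`) for every arithmetic Frobenius `φ` at `𝔓₀` and
  every `τ ∈ I_{𝔓₀}` acting on `μ_{N𝔮}` by `η_𝔮`;
* one inertia element `τ₀ ∈ I_{K_𝔮}` with `χ_{N𝔮}(τ₀) = η_𝔮` (`hτ₀`; over `ℚ` every unit is a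
  value of `χ_ℓ` on `I_ℓ`),
the classes satisfy **`loc^s_𝔮 [Φ] = φ^{fs}_𝔮 (loc_𝔮 [Φ_r])`**
(`singularLocalization ρ 𝔮 [Φ] = D.fsLocalization 𝔮 [Φ_r]`, the `fs_rel` clause of
`KolyvaginDatum.IsKolyvaginSystem`).  Proof: with `z = Φ_r ∘ res`, `w = Φ ∘ res` and any `w₀`
lifting `φ^{fs}[z]`, the predicate gives `w₀(τ) = Q(φ⁻¹) z(φ) = w(τ)` at every admissible `τ`;
`w − w₀` is a homomorphism on `I_{K_𝔮}` (unramified module) vanishing at `τ₀^a τ′` whenever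
`χ(τ₀^a τ′) = η`, and `η` generates, so it vanishes on `I_{K_𝔮}`: `[w] − [w₀]` is unramified
(X11b `LocBridge.mem_unramifiedSubgroup_one_iff_forall_eq_zero`).
0 defs, 0 facts.  References: K. Rubin, PCMI 18 (2011), Def. 1.9.6, Prop. 1.9.5; B. Mazur,
K. Rubin, Mem. AMS 799 (2004), Def. 1.2.2; C.-H. Kim, arXiv:2203.12159, §2.1.2–§2.2.2;
J. Neukirch, *Algebraic Number Theory*, Ch. II (9.6).
-/

noncomputable section

open Field IsDedekindDomain Polynomial
open scoped NumberField
open Literature.NumberTheory.GaloisRepresentations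
open Literature.NumberTheory.GaloisRepresentations.DiscreteGaloisModule
open Literature.NumberTheory.GaloisRepresentations.IsNonarchimedeanLocalField
open Literature.NumberTheory.GaloisCohomology
open Summit.BirchSwinnertonDyer.Rank1Residual.X11b

universe u

namespace Summit.BirchSwinnertonDyer.Rank1Residual.GaloisImage.Derivative.FS

variable {K : Type u} [Field K] [NumberField K]
variable {M : Type u} [AddCommGroup M] [TopologicalSpace M] [DiscreteTopology M]

/-- **A cocycle of an unramified local module vanishing at every inertia element of a given
GENERATING character value vanishes on the whole inertia group.**  `F` a non-archimedean local
field, `ρ` trivial on `I_F`, `χ : Γ_F → R` a homomorphism with `χ(I_F) ⊆ ⟨η⟩`, `η` of finite order,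
`τ₀ ∈ I_F` with `χ(τ₀) = η`; if the cocycle `d` vanishes at every `τ ∈ I_F` with `χ(τ) = η`, then
`d(I_F) = 0`: `d` is a homomorphism on `I_F`, and `χ(τ₀^a τ) = η` for `a = 1 + (ord η − 1)·j` when
`χ(τ) = η^j`. [folklore] -/
theorem apply_eq_zero_of_forall_apply_eq_zero_of_character {F : Type u} [Field F] [ValuativeRel F]
    [TopologicalSpace F] [IsNonarchimedeanLocalField F] (ρ : DiscreteGaloisModule F M)
    (hI : ∀ τ ∈ absInertia F, ∀ w : M, ρ τ w = w) {R : Type*} [Monoid R]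
    (χ : absoluteGaloisGroup F →* R) {η : R} (hη : ∀ τ ∈ absInertia F, χ τ ∈ Submonoid.powers η)
    (hfin : IsOfFinOrder η) {τ₀ : absoluteGaloisGroup F} (hτ₀I : τ₀ ∈ absInertia F) (hτ₀ : χ τ₀ = η)
    (d : contOneCocycles ρ.toTopRep) (hd : ∀ τ ∈ absInertia F, χ τ = η → d.1 τ = 0)
    {τ : absoluteGaloisGroup F} (hτ : τ ∈ absInertia F) : d.1 τ = 0 := by
  -- `d` on powers of `τ₀`
  have hpow : ∀ i : ℕ, d.1 (τ₀ ^ i) = 0 := by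
    intro i
    induction i with
    | zero => rw [pow_zero]; exact contOneCocycles.apply_one d
    | succ i ih =>
      rw [pow_succ, d.2, ih, hd τ₀ hτ₀I hτ₀, zero_add]
      exact map_zero _
  -- `χ τ = η ^ j`, and `χ (τ₀ ^ a * τ) = η` for `a = 1 + (orderOf η - 1) * j`
  obtain ⟨j, hj⟩ := hη τ hτ
  set a : ℕ := 1 + (orderOf η - 1) * j with ha
  have hχ : χ (τ₀ ^ a * τ) = η := by
    rw [map_mul, map_pow, hτ₀, ← hj, ← pow_add]
    have h1 : a + j = 1 + orderOf η * j := by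
      rw [ha]
      have := hfin.orderOf_pos
      zify [this]
      ring
    rw [h1, pow_add, pow_one, pow_mul, pow_orderOf_eq_one, one_pow, mul_one]
  have hmem : τ₀ ^ a * τ ∈ absInertia F := Subgroup.mul_mem _ (Subgroup.pow_mem _ hτ₀I a) hτ
  have h := hd _ hmem hχ
  rw [d.2, hpow, zero_add] at h
  -- `ρ (τ₀ ^ a)` acts trivially
  have htriv : ρ.toTopRep.ρ (τ₀ ^ a) (d.1 τ) = d.1 τ := hI _ (Subgroup.pow_mem _ hτ₀I a) _
  rw [htriv] at h
  exact h

variable (ρ : DiscreteGaloisModule K M) (N : ℕ) [Module (ZMod N) M] [Module.Free (ZMod N) M]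
  [Module.Finite (ZMod N) M]

/-- **The local–global glue for the finite–singular relation.**  See the module docstring: for a
Kolyvagin datum `D` with the canonical comparison maps (`hD`), `𝔮 ∈ 𝒫`, `ρ` unramified at
`𝔓₀ = adicCompletionPrime K 𝔮` (`hI`), global cocycles `Φ`, `Φ_r` with `Φ_r(I_{𝔓₀}) = 0` and the
cocycle-form relation `Φ(τ) = Q(φ⁻¹) Φ_r(φ)` at every arithmetic Frobenius `φ` at `𝔓₀` and every
`τ ∈ I_{𝔓₀}` with `χ_{N𝔮}(τ) = η_𝔮` (`hΦ`), and an inertia element of `K_𝔮` with character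
`η_𝔮` (`hτ₀`): **`loc^s_𝔮 [Φ] = φ^{fs}_𝔮 (loc_𝔮 [Φ_r])`**.
[cite: Rubin2011, Def. 1.9.6 (p. 14)] [cite: MazurRubin2004, Def. 1.2.2]
[cite: Kim2022StructureSelmer, §2.1.2–§2.2.2] -/
theorem singularLocalization_eq_fsLocalization_of_forall_apply_eq (D : KolyvaginDatum ρ)
    {η : (q : HeightOneSpectrum (𝓞 K)) → (ZMod (Ideal.absNorm q.asIdeal))ˣ}
    (hD : D.HasCanonicalComparison N η) {q : HeightOneSpectrum (𝓞 K)} (hq : q ∈ D.primes)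
    (hI : ∀ τ ∈ (adicCompletionPrime K q).inertia (absoluteGaloisGroup K), ∀ w : M, ρ τ w = w)
    (Φ Φr : contOneCocycles ρ.toTopRep)
    (hΦr : ∀ τ ∈ (adicCompletionPrime K q).inertia (absoluteGaloisGroup K), Φr.1 τ = 0)
    (hΦ : ∀ φ : absoluteGaloisGroup K, IsArithFrobAt (𝓞 K) φ (adicCompletionPrime K q) →
      ∀ τ ∈ (adicCompletionPrime K q).inertia (absoluteGaloisGroup K),
        modNCyclotomicCharacter K (Ideal.absNorm q.asIdeal) τ = η q →
          Φ.1 τ = ρ.comparisonOp N φ (Φr.1 φ))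
    {τ₀ : absoluteGaloisGroup (q.adicCompletion K)} (hτ₀I : τ₀ ∈ absInertia (q.adicCompletion K))
    (hτ₀ : localNormCyclotomicCharacter q τ₀ = η q) :
    KolyvaginDatum.singularLocalization ρ q (oneCocycleClass ρ.toTopRep Φ) =
      D.fsLocalization q (oneCocycleClass ρ.toTopRep Φr) := by
  classical
  -- the local module is unramified
  have hIloc : ∀ τ ∈ absInertia (q.adicCompletion K), ∀ w : M, GaloisRep.toLocal q ρ τ w = w := by
    intro τ hτ w
    rw [GaloisRep.toLocal_apply]
    refine hI _ ?_ w
    rw [inertia_adicCompletionPrime_eq_map_absInertia]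
    exact Subgroup.mem_map_of_mem _ hτ
  -- the local cocycles `z = Φ_r ∘ res`, `w = Φ ∘ res`
  let z : contOneCocycles (GaloisRep.toLocal q ρ).toTopRep :=
    contOneCocycles.pullback (absGaloisRestrict K (q.adicCompletion K)) (X := ρ.toTopRep)
      (Y := (GaloisRep.toLocal q ρ).toTopRep)
      (TopRep.ofHom ⟨ContinuousLinearMap.id ℤ M, fun _ => rfl⟩) Φr
  let w : contOneCocycles (GaloisRep.toLocal q ρ).toTopRep :=
    contOneCocycles.pullback (absGaloisRestrict K (q.adicCompletion K)) (X := ρ.toTopRep)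
      (Y := (GaloisRep.toLocal q ρ).toTopRep)
      (TopRep.ofHom ⟨ContinuousLinearMap.id ℤ M, fun _ => rfl⟩) Φ
  have hz : galoisCohomology.localization ρ (Sum.inr q) 1 (oneCocycleClass ρ.toTopRep Φr) =
      oneCocycleClass _ z := PrimeChoice.localization_inr_oneCocycleClass ρ q Φr
  have hw : galoisCohomology.localization ρ (Sum.inr q) 1 (oneCocycleClass ρ.toTopRep Φ) =
      oneCocycleClass _ w := PrimeChoice.localization_inr_oneCocycleClass ρ q Φ
  -- `[z]` is unramified
  have hres_mem : ∀ τ ∈ absInertia (q.adicCompletion K),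
      absGaloisRestrict K (q.adicCompletion K) τ ∈
        (adicCompletionPrime K q).inertia (absoluteGaloisGroup K) := by
    intro τ hτ
    rw [inertia_adicCompletionPrime_eq_map_absInertia]
    exact Subgroup.mem_map_of_mem _ hτ
  have hz_unr : oneCocycleClass _ z ∈ unramifiedSubgroup (GaloisRep.toLocal q ρ) 1 := by
    rw [LocBridge.mem_unramifiedSubgroup_one_iff_forall_eq_zero (GaloisRep.toLocal q ρ) hIloc]
    intro τ hτ
    exact hΦr _ (hres_mem τ hτ)
  -- a lift `w₀` of `φ^{fs}[z]`
  obtain ⟨c₀, hc₀⟩ := QuotientAddGroup.mk'_surjective (unramifiedSubgroup (GaloisRep.toLocal q ρ) 1)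
    (D.fs q (oneCocycleClass _ z))
  obtain ⟨w₀, rfl⟩ := oneCocycleClass_surjective _ c₀
  -- `w - w₀` vanishes at every admissible inertia element
  have hq_card : residueFieldCard (q.adicCompletion K) = Nat.card (𝓞 K ⧸ q.asIdeal) := by
    rw [Literature.NumberTheory.Automorphic.residueFieldCard_adicCompletion_eq K q,
      HeightOneSpectrum.residueCard_eq_card_quotient]
  obtain ⟨φ₀, hφ₀⟩ := exists_isAbsArithFrob_holds (q.adicCompletion K)
  have hvan : ∀ τ ∈ absInertia (q.adicCompletion K),
      localNormCyclotomicCharacter q τ = η q → (w - w₀).1 τ = 0 := by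
    intro τ hτ hχ
    have h1 : w₀.1 τ = DiscreteGaloisModule.comparisonOp (GaloisRep.toLocal q ρ) N φ₀ (z.1 φ₀) :=
      (hD.at hq hφ₀ hτ hχ).apply_eq z w₀ hz_unr hc₀
    have hφ₀' : IsArithFrobAt (𝓞 K) (absGaloisRestrict K (q.adicCompletion K) φ₀)
        (adicCompletionPrime K q) :=
      (isArithFrobAt_absGaloisRestrict_adicCompletionPrime_iff K q hq_card φ₀).2 hφ₀
    have hχ' : modNCyclotomicCharacter K (Ideal.absNorm q.asIdeal)
        (absGaloisRestrict K (q.adicCompletion K) τ) = η q := by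
      rw [← localNormCyclotomicCharacter_apply]; exact hχ
    have h2 : w.1 τ = ρ.comparisonOp N (absGaloisRestrict K (q.adicCompletion K) φ₀)
        (Φr.1 (absGaloisRestrict K (q.adicCompletion K) φ₀)) :=
      hΦ _ hφ₀' _ (hres_mem τ hτ) hχ'
    have h3 : DiscreteGaloisModule.comparisonOp (GaloisRep.toLocal q ρ) N φ₀ (z.1 φ₀) =
        ρ.comparisonOp N (absGaloisRestrict K (q.adicCompletion K) φ₀)
          (Φr.1 (absGaloisRestrict K (q.adicCompletion K) φ₀)) := by
      have hend : ∀ g : absoluteGaloisGroup (q.adicCompletion K),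
          DiscreteGaloisModule.zmodEnd (GaloisRep.toLocal q ρ) N g =
            ρ.zmodEnd N (absGaloisRestrict K (q.adicCompletion K) g) := fun g => by
        ext m; rw [zmodEnd_apply, zmodEnd_apply, GaloisRep.toLocal_apply]
      rw [comparisonOp_def, comparisonOp_def, comparisonQ, comparisonQ, comparisonP, comparisonP,
        hend, hend, map_inv]
      rfl
    rw [Submodule.coe_sub, ContinuousMap.sub_apply, h2, h1, h3, sub_self]
  -- hence on all of `I_{K_𝔮}`
  haveI : NeZero (Ideal.absNorm q.asIdeal) := inferInstance
  have hvanI : ∀ τ ∈ absInertia (q.adicCompletion K), (w - w₀).1 τ = 0 := fun τ hτ =>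
    apply_eq_zero_of_forall_apply_eq_zero_of_character (GaloisRep.toLocal q ρ) hIloc
      (localNormCyclotomicCharacter q) (fun τ' _ =>
        (isOfFinOrder_of_finite (η q)).mem_powers_iff_mem_zpowers.mpr
          (by rw [hD.zpowers_eq_top hq]; exact Subgroup.mem_top _))
      (isOfFinOrder_of_finite _) hτ₀I hτ₀ (w - w₀) hvan hτ
  have hunr : oneCocycleClass _ w - oneCocycleClass _ w₀ ∈
      unramifiedSubgroup (GaloisRep.toLocal q ρ) 1 := by
    rw [← oneCocycleClass_sub,
      LocBridge.mem_unramifiedSubgroup_one_iff_forall_eq_zero (GaloisRep.toLocal q ρ) hIloc]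
    exact hvanI
  -- conclude
  change singularMap (GaloisRep.toLocal q ρ)
      (galoisCohomology.localization ρ (Sum.inr q) 1 (oneCocycleClass ρ.toTopRep Φ)) =
    D.fs q (galoisCohomology.localization ρ (Sum.inr q) 1 (oneCocycleClass ρ.toTopRep Φr))
  rw [hw, hz, ← hc₀]
  change singularMap _ _ = singularMap _ _
  rw [← sub_eq_zero, ← map_sub, singularMap_eq_zero_iff]
  exact hunr

end Summit.BirchSwinnertonDyer.Rank1Residual.GaloisImage.Derivative.FS

end
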